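import Summits.AtomisticToContinuum.BoseEinsteinCondensation.Theses.BECStronglyRayleigh
import Literature.MathematicalPhysics.QuantumManyBody.BoseGasCatStates
import Literature.MathematicalPhysics.QuantumManyBody.PeriodicBoseGasMomentumSector

/-!
# Negative lemmas for crux `LatticeToPeriodicBridge` (stmt-AtomisticToContinuum-9674), III-a:
# a free two-body near-minimiser with a bump — the witness state

Supports stmt-AtomisticToContinuum-9674 (route `BECStronglyRayleigh`, rank 4). Data and estimates of
the `v = 0` witness used in part III-b (`Negative/TwoBodyCellLorentzian.lean`) to refute the typed
First lemma `TwoBodyCellLorentzian` of the crux-ideate card `coarse-cell-lorentzian`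
(`Cruxes/LatticeToPeriodicBridge/IdeatorSketch1.lean`):

* `blockPair`, `dilatedPair`, `pairPer` — the two-body block state of `BoseGasCatStates` (both
  particles in the unit bump of block `0`), dilated into `(L/8, 3L/8)⁶` and periodised on the torus of
  side `L`; support (`dilatedPair_support`), finite free energy (`energy_dilatedPair_lt_top`,
  `periodicEnergy_pairPer_lt_top`), a uniform bound (`exists_bound_dilatedPair`).
* `witnessFun hL ε = 1 + ε |Θ_per|²` (real, `≥ 1`, `C¹`, periodic, symmetric) and the normalised
  `witness hL hε : PeriodicTrialState 2 L` with constant `witnessConst` (`k_ε² ≤ L⁻⁶`,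
  `witnessConst_sq_le`); `witness_real_nonneg`.
* `kineticDensity_witnessFun_le` — product rule `|∇W_ε|² ≤ (2εS)²|∇Θ_per|²`, whence
  `periodicEnergy_witness_le`: `𝓔^per_0[Ψ_ε] ≤ k_ε²(2εS)² 𝓔^per_0[Θ_per] = O(ε²)`.

Definitions are data (the witness), not `Prop`s; no statement of the route is asserted. `[folklore]`.
-/

noncomputable section

namespace Summit.AtomisticToContinuum.BoseEinsteinCondensation.Theorems.LatticeToPeriodicBridge.Negative

open Literature.MathematicalPhysics.QuantumManyBody.BoseGas
open _root_.MeasureTheory _root_.Filter _root_.Topology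
open scoped ENNReal NNReal

/-! ## A two-body Dirichlet product state living in the first half-cell -/

/-- Two particles in the unit bump of block `0` of the side-`4` box: a Dirichlet trial state whose
wave function is supported in `(1/2, 3/2)³ × (1/2, 3/2)³`. [folklore] -/
def blockPair : TrialState 2 (2 * ((2 : ℕ) : ℝ)) :=
  ((blockState 2 2 (0 : Block 2)).mono fun _ hx => blockSet_subset_box 2 hx).toTrialState

/-- The wave function of `blockPair` is that of the block state. [folklore] -/
theorem blockPair_ψ (X : Config 2) :
    blockPair.ψ X = (blockState 2 2 (0 : Block 2)).ψ X := rfl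

/-- Function-level form of `blockPair_ψ`. [folklore] -/
theorem blockPair_ψ_eq : blockPair.ψ = (blockState 2 2 (0 : Block 2)).ψ := rfl

/-- Where `blockPair` is non-zero, every coordinate lies in `(1/2, 3/2)`. [folklore] -/
theorem blockPair_support {X : Config 2} (h : blockPair.ψ X ≠ 0) (i : Fin 2) (k : Fin 3) :
    1 / 2 < X i k ∧ X i k < 3 / 2 := by
  have hm := mem_blockSet_of_blockState_ne_zero (by rwa [blockPair_ψ] at h) i
  have := (mem_blockSet 2).1 hm k
  simp only [Pi.zero_apply, Fin.val_zero, CharP.cast_eq_zero, mul_zero, zero_add] at this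
  exact this

/-- The free energy of `blockPair` is `2 𝓔₀[β] < ⊤`. [folklore] -/
theorem energy_blockPair : energy 0 blockPair = 2 * energy 0 unitBump := by
  rw [energy_eq_rawEnergy]
  have h := rawEnergy_zero_blockState (N := 2) (m := 2) 0
  rw [blockPair_ψ_eq] ; exact_mod_cast h

/-- `blockPair` has finite free energy. [folklore] -/
theorem energy_blockPair_lt_top : energy 0 blockPair < ⊤ := by
  rw [energy_blockPair]
  exact ENNReal.mul_lt_top (by simp) energy_unitBump_lt_top

/-- The block pair dilated to the torus cell of side `L`: supported in `(L/8, 3L/8)⁶`. [folklore] -/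
def dilatedPair {L : ℝ} (hL : 0 < L) : TrialState 2 L :=
  (blockPair.dilate (s := L / 4) (by positivity)).castLen (by push_cast; ring)

/-- The wave function of the dilated pair. [folklore] -/
theorem dilatedPair_ψ {L : ℝ} (hL : 0 < L) (Y : Config 2) :
    (dilatedPair hL).ψ Y =
      (Real.sqrt (((L / 4) ^ Module.finrank ℝ (Config 2))⁻¹) : ℂ) * blockPair.ψ ((L / 4)⁻¹ • Y) := by
  rw [dilatedPair, TrialState.castLen_ψ, TrialState.dilate_ψ]

/-- Support of the dilated pair. [folklore] -/
theorem dilatedPair_support {L : ℝ} (hL : 0 < L) {Y : Config 2} (h : (dilatedPair hL).ψ Y ≠ 0)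
    (i : Fin 2) (k : Fin 3) : L / 8 < Y i k ∧ Y i k < 3 * L / 8 := by
  rw [dilatedPair_ψ] at h
  have h' : blockPair.ψ ((L / 4)⁻¹ • Y) ≠ 0 := fun h0 => h (by rw [h0, mul_zero])
  have := blockPair_support h' i k
  simp only [Pi.smul_apply, PiLp.smul_apply, smul_eq_mul] at this
  have h4 : (0 : ℝ) < L / 4 := by positivity
  rw [← div_eq_inv_mul, lt_div_iff₀ h4, div_lt_iff₀ h4] at this
  constructor <;> linarith [this.1, this.2]

/-- Finite free energy of the dilated pair. [folklore] -/
theorem energy_dilatedPair_lt_top {L : ℝ} (hL : 0 < L) : energy 0 (dilatedPair hL) < ⊤ := by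
  rw [dilatedPair, TrialState.energy_castLen]
  have h := TrialState.energy_dilate 0 blockPair (s := L / 4) (by positivity)
  rw [scalePotential_zero] at h
  rw [h]
  exact ENNReal.mul_lt_top ENNReal.ofReal_lt_top energy_blockPair_lt_top

/-- The dilated pair is bounded (continuous with compact support). [folklore] -/
theorem hasCompactSupport_dilatedPair {L : ℝ} (hL : 0 < L) :
    HasCompactSupport (dilatedPair hL).ψ := by
    refine HasCompactSupport.intro (isCompact_closedBall (0 : Config 2) (3 * L)) fun Y hY => ?_
    by_contra h
    apply hY
    rw [Metric.mem_closedBall, dist_zero_right, pi_norm_le_iff_of_nonneg (by positivity)]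
    intro i
    have hcoord := fun k => dilatedPair_support hL h i k
    rw [EuclideanSpace.norm_eq]
    calc Real.sqrt (∑ k, ‖Y i k‖ ^ 2) ≤ Real.sqrt (∑ _k : Fin 3, L ^ 2) := by
          refine Real.sqrt_le_sqrt (Finset.sum_le_sum fun k _ => ?_)
          rw [Real.norm_eq_abs, sq_abs]
          have := hcoord k
          nlinarith [this.1, this.2, hL]
      _ ≤ Real.sqrt ((3 * L) ^ 2) := by
          refine Real.sqrt_le_sqrt ?_
          simp only [Finset.sum_const, Finset.card_univ, Fintype.card_fin, nsmul_eq_mul]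
          push_cast
          nlinarith [hL]
      _ = 3 * L := Real.sqrt_sq (by positivity)

/-- The dilated pair is bounded (continuous with compact support). [folklore] -/
theorem exists_bound_dilatedPair {L : ℝ} (hL : 0 < L) :
    ∃ S : ℝ, 0 ≤ S ∧ ∀ Y, ‖(dilatedPair hL).ψ Y‖ ≤ S := by
  obtain ⟨C, hC⟩ := (dilatedPair hL).contDiff.continuous.bounded_above_of_compact_support
    (hasCompactSupport_dilatedPair hL)
  exact ⟨max C 0, le_max_right _ _, fun Y => (hC Y).trans (le_max_left _ _)⟩

/-! ## The periodic witness `W_ε = 1 + ε |Θ_per|²` -/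

section Witness

variable {L : ℝ}

/-- The dilated pair periodised on the torus of side `L`. [folklore] -/
def pairPer (hL : 0 < L) : PeriodicTrialState 2 L := (dilatedPair hL).toPeriodic hL le_rfl

/-- The periodised pair is the periodisation of the dilated pair. [folklore] -/
theorem pairPer_ψ (hL : 0 < L) (X : Config 2) :
    (pairPer hL).ψ X = periodize L (dilatedPair hL).ψ X := rfl

/-- On the fundamental cell the periodised pair is the dilated pair. [folklore] -/
theorem pairPer_ψ_of_mem (hL : 0 < L) {X : Config 2} (hX : X ∈ cellN 2 L) :
    (pairPer hL).ψ X = (dilatedPair hL).ψ X :=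
  periodize_of_mem_cellN hL _ hX

/-- A bound of the Dirichlet state bounds its periodisation (which only re-evaluates it). [folklore] -/
theorem norm_pairPer_le (hL : 0 < L) {S : ℝ} (hS : ∀ Y, ‖(dilatedPair hL).ψ Y‖ ≤ S) (X : Config 2) :
    ‖(pairPer hL).ψ X‖ ≤ S :=
  hS _

/-- The periodised pair has finite free periodic energy. [folklore] -/
theorem periodicEnergy_pairPer_lt_top (hL : 0 < L) : periodicEnergy 0 (pairPer hL) < ⊤ :=
  lt_of_le_of_lt ((dilatedPair hL).periodicEnergy_toPeriodic_le (v := 0) (R₀ := 0)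
    (fun _ _ => rfl) hL le_rfl (by linarith)) (energy_dilatedPair_lt_top hL)

/-- The (un-normalised) witness `W_ε(X) = 1 + ε |Θ_per(X)|²`, real and `≥ 1`. [folklore] -/
def witnessFun (hL : 0 < L) (ε : ℝ) (X : Config 2) : ℂ :=
  ((1 + ε * ‖(pairPer hL).ψ X‖ ^ 2 : ℝ) : ℂ)

/-- Real part of the witness. [folklore] -/
theorem witnessFun_re (hL : 0 < L) (ε : ℝ) (X : Config 2) :
    (witnessFun hL ε X).re = 1 + ε * ‖(pairPer hL).ψ X‖ ^ 2 :=
  rfl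

/-- The witness is real. [folklore] -/
theorem witnessFun_im (hL : 0 < L) (ε : ℝ) (X : Config 2) : (witnessFun hL ε X).im = 0 :=
  rfl

/-- The witness is at least `1`. [folklore] -/
theorem one_le_witnessFun_re (hL : 0 < L) {ε : ℝ} (hε : 0 ≤ ε) (X : Config 2) :
    1 ≤ (witnessFun hL ε X).re := by
  rw [witnessFun_re]
  nlinarith [sq_nonneg ‖(pairPer hL).ψ X‖]

/-- Modulus of the witness. [folklore] -/
theorem norm_witnessFun (hL : 0 < L) {ε : ℝ} (hε : 0 ≤ ε) (X : Config 2) :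
    ‖witnessFun hL ε X‖ = 1 + ε * ‖(pairPer hL).ψ X‖ ^ 2 := by
  rw [witnessFun, Complex.norm_real, Real.norm_of_nonneg (by positivity)]

/-- The modulus of the witness is at least `1`. [folklore] -/
theorem one_le_norm_witnessFun (hL : 0 < L) {ε : ℝ} (hε : 0 ≤ ε) (X : Config 2) :
    1 ≤ ‖witnessFun hL ε X‖ := by
  rw [norm_witnessFun hL hε]; nlinarith [sq_nonneg ‖(pairPer hL).ψ X‖]

/-- The modulus of the witness is at most `1 + εS²`. [folklore] -/
theorem norm_witnessFun_le (hL : 0 < L) {ε S : ℝ} (hε : 0 ≤ ε) (hS : ∀ Y, ‖(dilatedPair hL).ψ Y‖ ≤ S)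
    (X : Config 2) : ‖witnessFun hL ε X‖ ≤ 1 + ε * S ^ 2 := by
  rw [norm_witnessFun hL hε]
  have h := norm_pairPer_le hL hS X
  have h0 : 0 ≤ ‖(pairPer hL).ψ X‖ := norm_nonneg _
  nlinarith [mul_le_mul h h h0 (h0.trans h)]

/-- The witness is `C¹`. [folklore] -/
theorem contDiff_witnessFun (hL : 0 < L) (ε : ℝ) : ContDiff ℝ 1 (witnessFun hL ε) := by
  unfold witnessFun
  exact Complex.ofRealCLM.contDiff.comp
    (contDiff_const.add (contDiff_const.mul ((pairPer hL).contDiff.norm_sq ℝ)))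

/-- The witness is `Lℤ³`-periodic in each particle. [folklore] -/
theorem witnessFun_periodic (hL : 0 < L) (ε : ℝ) (X : Config 2) (i : Fin 2) (a : Fin 3) :
    witnessFun hL ε (X + Pi.single i (EuclideanSpace.single a L)) = witnessFun hL ε X := by
  simp only [witnessFun, (pairPer hL).periodic]

/-- The witness is Bose-symmetric. [folklore] -/
theorem witnessFun_symm (hL : 0 < L) (ε : ℝ) (σ : Equiv.Perm (Fin 2)) (X : Config 2) :
    witnessFun hL ε (X ∘ σ) = witnessFun hL ε X := by
  simp only [witnessFun, (pairPer hL).symm]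

/-- The `L²(cell)`-norm of the witness is at least the volume `L⁶`. [folklore] -/
theorem volume_le_lintegral_witnessFun (hL : 0 < L) {ε : ℝ} (hε : 0 ≤ ε) :
    (ENNReal.ofReal L ^ 3) ^ 2 ≤ ∫⁻ X in cellN 2 L, ((‖witnessFun hL ε X‖₊ : ℝ≥0∞)) ^ 2 := by
  rw [← volume_cellN 2 L, ← setLIntegral_one]
  refine setLIntegral_mono' (measurableSet_cellN 2 L) fun X _ => ?_
  rw [coe_nnnorm_sq_eq_ofReal, ← ENNReal.ofReal_one]
  refine ENNReal.ofReal_le_ofReal ?_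
  nlinarith [one_le_norm_witnessFun hL hε X]

/-- … and at most `(1 + εS²)² L⁶ < ⊤`. [folklore] -/
theorem lintegral_witnessFun_le (hL : 0 < L) {ε S : ℝ} (hε : 0 ≤ ε)
    (hS : ∀ Y, ‖(dilatedPair hL).ψ Y‖ ≤ S) :
    ∫⁻ X in cellN 2 L, ((‖witnessFun hL ε X‖₊ : ℝ≥0∞)) ^ 2 ≤
      ENNReal.ofReal ((1 + ε * S ^ 2) ^ 2) * (ENNReal.ofReal L ^ 3) ^ 2 := by
  rw [← volume_cellN 2 L, ← setLIntegral_const]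
  refine setLIntegral_mono' (measurableSet_cellN 2 L) fun X _ => ?_
  rw [coe_nnnorm_sq_eq_ofReal]
  exact ENNReal.ofReal_le_ofReal
    (pow_le_pow_left₀ (norm_nonneg _) (norm_witnessFun_le hL hε hS X) 2)

/-- The witness has non-zero norm on the cell. [folklore] -/
theorem lintegral_witnessFun_ne_zero (hL : 0 < L) {ε : ℝ} (hε : 0 ≤ ε) :
    ∫⁻ X in cellN 2 L, ((‖witnessFun hL ε X‖₊ : ℝ≥0∞)) ^ 2 ≠ 0 := by
  have hpos : 0 < (ENNReal.ofReal L ^ 3) ^ 2 := by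
    have : 0 < ENNReal.ofReal L := ENNReal.ofReal_pos.2 hL
    positivity
  exact (hpos.trans_le (volume_le_lintegral_witnessFun hL hε)).ne'

/-- The witness has finite norm on the cell. [folklore] -/
theorem lintegral_witnessFun_ne_top (hL : 0 < L) {ε : ℝ} (hε : 0 ≤ ε) :
    ∫⁻ X in cellN 2 L, ((‖witnessFun hL ε X‖₊ : ℝ≥0∞)) ^ 2 ≠ ⊤ := by
  obtain ⟨S, -, hS⟩ := exists_bound_dilatedPair hL
  exact ne_top_of_le_ne_top (ENNReal.mul_ne_top ENNReal.ofReal_ne_top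
    (ENNReal.pow_ne_top (ENNReal.pow_ne_top ENNReal.ofReal_ne_top))) (lintegral_witnessFun_le hL hε hS)

/-- The normalised witness state `Ψ_ε = W_ε / ‖W_ε‖`. [folklore] -/
def witness (hL : 0 < L) {ε : ℝ} (hε : 0 ≤ ε) : PeriodicTrialState 2 L :=
  PeriodicTrialState.ofFun (witnessFun hL ε) (contDiff_witnessFun hL ε) (witnessFun_periodic hL ε)
    (witnessFun_symm hL ε) (lintegral_witnessFun_ne_zero hL hε) (lintegral_witnessFun_ne_top hL hε)

/-- Its normalising constant `k_ε = ‖W_ε‖⁻¹`. [folklore] -/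
def witnessConst (hL : 0 < L) (ε : ℝ) : ℝ :=
  (Real.sqrt (∫⁻ X in cellN 2 L, ((‖witnessFun hL ε X‖₊ : ℝ≥0∞)) ^ 2).toReal)⁻¹

/-- The normalised witness is `k_ε W_ε`. [folklore] -/
theorem witness_ψ (hL : 0 < L) {ε : ℝ} (hε : 0 ≤ ε) (X : Config 2) :
    (witness hL hε).ψ X = (witnessConst hL ε : ℂ) * witnessFun hL ε X := by
  unfold witness witnessConst
  rw [PeriodicTrialState.ofFun_apply, Complex.ofReal_inv]

/-- Function-level form of `witness_ψ`. [folklore] -/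
theorem witness_ψ_eq (hL : 0 < L) {ε : ℝ} (hε : 0 ≤ ε) :
    (witness hL hε).ψ = fun X => (witnessConst hL ε : ℂ) * witnessFun hL ε X :=
  funext (witness_ψ hL hε)

/-- `k_ε > 0`. [folklore] -/
theorem witnessConst_pos (hL : 0 < L) {ε : ℝ} (hε : 0 ≤ ε) : 0 < witnessConst hL ε := by
  unfold witnessConst
  refine inv_pos.2 (Real.sqrt_pos.2 (ENNReal.toReal_pos (lintegral_witnessFun_ne_zero hL hε)
    (lintegral_witnessFun_ne_top hL hε)))

/-- `k_ε² ≤ L⁻⁶`. [folklore] -/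
theorem witnessConst_sq_le (hL : 0 < L) {ε : ℝ} (hε : 0 ≤ ε) :
    witnessConst hL ε ^ 2 ≤ (L ^ 6)⁻¹ := by
  unfold witnessConst
  set I := ∫⁻ X in cellN 2 L, ((‖witnessFun hL ε X‖₊ : ℝ≥0∞)) ^ 2 with hI
  have hItop : I ≠ ⊤ := lintegral_witnessFun_ne_top hL hε
  have hIpos : 0 < I.toReal := ENNReal.toReal_pos (lintegral_witnessFun_ne_zero hL hε) hItop
  have hL6 : L ^ 6 ≤ I.toReal := by
    have h := volume_le_lintegral_witnessFun hL hε
    rw [← hI] at h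
    have h' : ((ENNReal.ofReal L ^ 3) ^ 2).toReal ≤ I.toReal := ENNReal.toReal_mono hItop h
    rwa [ENNReal.toReal_pow, ENNReal.toReal_pow, ENNReal.toReal_ofReal hL.le, ← pow_mul] at h'
  rw [inv_pow, Real.sq_sqrt hIpos.le]
  exact inv_anti₀ (by positivity) hL6

/-- The witness is real and non-negative. [folklore] -/
theorem witness_real_nonneg (hL : 0 < L) {ε : ℝ} (hε : 0 ≤ ε) (X : Config 2) :
    0 ≤ ((witness hL hε).ψ X).re ∧ ((witness hL hε).ψ X).im = 0 := by
  rw [witness_ψ, Complex.mul_re, Complex.mul_im, witnessFun_im, Complex.ofReal_re,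
    Complex.ofReal_im]
  refine ⟨?_, by ring⟩
  simp only [mul_zero, sub_zero]
  exact mul_nonneg (witnessConst_pos hL hε).le ((one_le_witnessFun_re hL hε X).trans' zero_le_one)

/-- `‖a‖ ≤ c ‖b‖` in squared `ℝ≥0∞` form. [folklore] -/
theorem ennnorm_sq_le_of_norm_le {α β : Type*} [SeminormedAddCommGroup α] [SeminormedAddCommGroup β]
    {a : α} {b : β} {c : ℝ} (h : ‖a‖ ≤ c * ‖b‖) :
    ((‖a‖₊ : ℝ≥0∞)) ^ 2 ≤ ENNReal.ofReal (c ^ 2) * ((‖b‖₊ : ℝ≥0∞)) ^ 2 := by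
  rw [coe_nnnorm_sq_eq_ofReal, coe_nnnorm_sq_eq_ofReal, ← ENNReal.ofReal_mul (sq_nonneg _)]
  refine ENNReal.ofReal_le_ofReal ?_
  calc ‖a‖ ^ 2 ≤ (c * ‖b‖) ^ 2 := pow_le_pow_left₀ (norm_nonneg _) h 2
    _ = c ^ 2 * ‖b‖ ^ 2 := by ring

/-- **Product-rule bound**: `|∇W_ε|² ≤ (2εS)² |∇Θ_per|²` pointwise. [folklore] -/
theorem kineticDensity_witnessFun_le (hL : 0 < L) {ε S : ℝ} (hε : 0 ≤ ε)
    (hS : ∀ Y, ‖(dilatedPair hL).ψ Y‖ ≤ S) (X : Config 2) :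
    kineticDensity (witnessFun hL ε) X ≤
      ENNReal.ofReal ((2 * ε * S) ^ 2) * kineticDensity (pairPer hL).ψ X := by
  set f : Config 2 → ℂ := (pairPer hL).ψ with hf
  have hdf : HasFDerivAt f (fderiv ℝ f X) X :=
    (((pairPer hL).contDiff.differentiable one_ne_zero) X).hasFDerivAt
  have hg : HasFDerivAt (fun Y => ‖f Y‖ ^ 2) (2 • (innerSL ℝ (f X)).comp (fderiv ℝ f X)) X :=
    hdf.norm_sq
  have h1 : HasFDerivAt (fun Y => (1 : ℝ) + ε * ‖f Y‖ ^ 2)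
      (ε • (2 • (innerSL ℝ (f X)).comp (fderiv ℝ f X))) X :=
    (hg.const_mul ε).const_add 1
  have hw : HasFDerivAt (witnessFun hL ε)
      (Complex.ofRealCLM.comp (ε • (2 • (innerSL ℝ (f X)).comp (fderiv ℝ f X)))) X :=
    Complex.ofRealCLM.hasFDerivAt.comp X h1
  unfold kineticDensity
  rw [hw.fderiv, Finset.mul_sum]
  refine Finset.sum_le_sum fun i _ => ?_
  rw [Finset.mul_sum]
  refine Finset.sum_le_sum fun k _ => ?_
  refine ennnorm_sq_le_of_norm_le ?_
  set v : Config 2 := Pi.single i (EuclideanSpace.single k (1 : ℝ))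
  have hin : |@inner ℝ ℂ _ (f X) (fderiv ℝ f X v)| ≤ ‖f X‖ * ‖fderiv ℝ f X v‖ :=
    abs_real_inner_le_norm _ _
  have hfX : ‖f X‖ ≤ S := norm_pairPer_le hL hS X
  have happ : (Complex.ofRealCLM.comp (ε • (2 • (innerSL ℝ (f X)).comp (fderiv ℝ f X)))) v =
      ((ε * (2 * @inner ℝ ℂ _ (f X) (fderiv ℝ f X v)) : ℝ) : ℂ) := by
    simp only [ContinuousLinearMap.comp_apply, smul_apply, innerSL_apply_apply,
      Complex.ofRealCLM_apply, smul_eq_mul, nsmul_eq_mul, Nat.cast_ofNat]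
  rw [happ, Complex.norm_real, Real.norm_eq_abs, abs_mul, abs_mul, abs_of_nonneg hε, abs_two]
  calc ε * (2 * |@inner ℝ ℂ _ (f X) (fderiv ℝ f X v)|) ≤ ε * (2 * (S * ‖fderiv ℝ f X v‖)) := by
        gcongr
        exact hin.trans (mul_le_mul_of_nonneg_right hfX (norm_nonneg _))
    _ = 2 * ε * S * ‖fderiv ℝ f X v‖ := by ring

/-- `v = 0`: the periodic interaction vanishes. [folklore] -/
theorem periodicInteraction_zero' (L : ℝ) (X : Config 2) : periodicInteraction 0 L X = 0 := by
  simp [periodicInteraction, periodizedPotential]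

/-- **Energy of the witness**: `𝓔^per_0[Ψ_ε] ≤ k_ε² (2εS)² 𝓔^per_0[Θ_per]`. [folklore] -/
theorem periodicEnergy_witness_le (hL : 0 < L) {ε S : ℝ} (hε : 0 ≤ ε)
    (hS : ∀ Y, ‖(dilatedPair hL).ψ Y‖ ≤ S) :
    periodicEnergy 0 (witness hL hε) ≤
      ENNReal.ofReal (witnessConst hL ε ^ 2) * ENNReal.ofReal ((2 * ε * S) ^ 2) *
        periodicEnergy 0 (pairPer hL) := by
  have hk0 : 0 ≤ witnessConst hL ε := (witnessConst_pos hL hε).le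
  unfold periodicEnergy
  simp only [periodicInteraction_zero', zero_mul, add_zero]
  calc ∫⁻ X in cellN 2 L, kineticDensity (witness hL hε).ψ X
      ≤ ∫⁻ X in cellN 2 L, ENNReal.ofReal (witnessConst hL ε ^ 2) *
          (ENNReal.ofReal ((2 * ε * S) ^ 2) * kineticDensity (pairPer hL).ψ X) := by
        refine lintegral_mono fun X => ?_
        have h1 : kineticDensity (witness hL hε).ψ X =
            ENNReal.ofReal (witnessConst hL ε ^ 2) * kineticDensity (witnessFun hL ε) X := by
          rw [witness_ψ_eq hL hε]
          exact kineticDensity_const_mul (contDiff_witnessFun hL ε) _ hk0 X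
        rw [h1]
        exact mul_le_mul' le_rfl (kineticDensity_witnessFun_le hL hε hS X)
    _ = ENNReal.ofReal (witnessConst hL ε ^ 2) * ENNReal.ofReal ((2 * ε * S) ^ 2) *
          ∫⁻ X in cellN 2 L, kineticDensity (pairPer hL).ψ X := by
        rw [lintegral_const_mul' _ _ ENNReal.ofReal_ne_top, lintegral_const_mul' _ _ ENNReal.ofReal_ne_top]
        ring

end Witness

end Summit.AtomisticToContinuum.BoseEinsteinCondensation.Theorems.LatticeToPeriodicBridge.Negative

end
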